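import Summits.ResolutionOfSingularities.ResolutionOfSingularities.Theorems.JetCutKernels
import HarnessLib

/-!
# JetCutKernels2 — decomp-res node «JetCut» (lens-2 g15 rev 5), file 2/2 of `JetCutKernels`

Content VERBATIM from the decomp-res lens-2 file `HOME/decomp-res-lens-2/g15/JetCut.lean` rev 5 (pin 9f53e5ca =
`parts/JetCut-rev5-9f53e5ca.lean`, 7 495 l;
HOME = run/shared/lean/pub/decomp-res; CRITIC-LEDGER rows 109 / 115 / 120 / 121 / 122 / 127 / 133 CLEARED; landing
order INBOX :231; the critic's
HYGIENE-landing.md h1–h11 applied — DOCSTRING-ONLY).  The lens's blocks RESTATED VERBATIM from lens-2 g12 / g13 /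
g14 (§R / §R13 / §R14) are DELETED:
they are the tree's `RelativeDeltaCut*` / `CurveLeafExit*` / `PinchCut*` modules (namespaces `RelativeDeltaCut`,
`CurveLeafExit`, `PinchCut`, opened;
the lens's `CurveLeafExitRestated.x` / `PinchCutRestated.x` are cited as `CurveLeafExit.x` / `PinchCut.x`, the three
pointwise engine edges of g12 as
`RelativeDeltaCut.x`).  Namespace `…Theorems.JetCut` (the lens's `Theses.JetCut` is gate-reserved), sub-namespaces
`Tame` / `Wide` / `Broad` / `Vast`
as in the lens; file split only (tree files ≤ 400 lines): sections, variables and every declaration exactly as in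
the lens, the long rev-0/1 prose
lives in HOME/decomp-res-lens-2/g15/NODE-g15.md §ARCHIVE-A (not in the tree).  Node files, in import order:
`JetCutJetKernels`, `JetCutPoint`, `JetCutClasses`, `JetCutKernels`, `JetCutTame`, `JetCutTameClasses`,
`JetCutTameKernels`, `JetCutLadder`, `JetCutWideClasses`, `JetCutWideKernels`, `JetCutMixed`, `JetCutBroadClasses`,
`JetCutBroadKernels`, `JetCutDegenerate`, `JetCutVastClasses`, `JetCutVastKernels`
(each possibly continued `…2`, `…3`), then the wiring `MaxContactCutJetCut*` (in the Theses cone).  All `--supports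
stmt-ResolutionOfSingularities-29273`
(`MaxContactCut.RungOne`); nothing closes 29273 — decided cells carry their engines as hypotheses, and exactly ONE
located-residual aside is booked on
the route for this column (`Vast.VastSpecialRung`, home `JetCutVastClasses`).

§K + the route-free part of §E: pure-logic KERNELS of the jet cut — pointwise exhaustion
`classGE_or_gen_or_jspecial`, projections of a jet-special point, the EXACT cut `seqDimFour_one_iff : SeqDimFour 1 n
⟺ SeqJGen n ∧ SeqJSpec n`, comparison edges with the g14/g13/g12/g11/g10 schemas, isolation / strata / REG–SING
sub-cuts, the ENGINE kernels at a point and the assemblies `jGenRungAt_of_engines` / `jetGenericRung_of_engines`,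
`flatConeExit_of_jetExit` ((J) subsumes (C)) — VERBATIM, 0 sorry.  Everything naming a `MaxContactCut` route item
(`rungOne_iff`, `closes*`, map / refinement edges) is in `MaxContactCutJetCut*`.

Part 2/2 carries: `jetGenericRung_of_engines`, `jetSpecialRung_iff_iso`, `jetSpecialRung_iff_leaves`,
`e_one_iff_families`, `pinchGenericRung_of_jetGenericRung`, `jetSpecialRung_of_pinchSpecialRung`,
`jetSpecCurveReg_of_pinchSpecCurveReg`, `jetSpecCurve_of_pinchSpecCurve`, `jetSpecNonIso_of_deltaSpecNonIso`.

(Sources: HunekeSwanson2006 Cor. 5.5.5; CossartJannsenSaito2020 Ch. 2, Thm. 3.6/3.7, Ch. 8; CossartPiltant2008 Prop.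
4.2; CossartPiltant2019 Rem. 3.2; Hironaka1964 Ch. III; Hironaka1967; Hironaka1977; Moh1987; Giraud1975.)
-/

open CategoryTheory AlgebraicGeometry TopologicalSpace IsLocalRing
open Literature.AlgebraicGeometry.Resolution
open Summit.ResolutionOfSingularities.ResolutionOfSingularities.Theorems
open Summit.ResolutionOfSingularities.ResolutionOfSingularities.Theorems.WeakOrderReduction
open Summit.ResolutionOfSingularities.ResolutionOfSingularities.Theorems.DeltaFaceCutClasses
open Summit.ResolutionOfSingularities.ResolutionOfSingularities.Theorems.RelativeDeltaCut
open Summit.ResolutionOfSingularities.ResolutionOfSingularities.Theorems.CurveLeafExit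
open Summit.ResolutionOfSingularities.ResolutionOfSingularities.Theorems.PinchCut

namespace Summit.ResolutionOfSingularities.ResolutionOfSingularities.Theorems.JetCut

section Kernels

variable {n : ℕ}

/-- **`JetGenericRung` is DECIDED modulo the typed pieces**: eight engines, g12's curve port at every marking `≥ 2`,
and the order-one contact port. [folklore] -/
theorem jetGenericRung_of_engines (hV : VeryNearCutClasses.VeryNearExit) (hD : DeltaPackageExit)
    (hU : UniformCurvePackageExit) (hR : RelCurvePackageExit) (hN : NormalConeJumpExit)
    (hM : MonomialPinchExit) (hC : FlatConeExit) (hJ : JetExit) (hP : ∀ n : ℕ, 2 ≤ n → CurvePackagePort n)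
    (h1 : FaceFormCutClasses.OrderOneContact) : JetGenericRung := by
  intro hE2 n hn
  by_cases h : 2 ≤ n
  · exact jGenRungAt_of_engines hV hD hU hR hN hM hC hJ (hP n h) h (hE2 n hn)
  · have hn1 : n = 1 := by omega
    subst hn1
    exact jGenRungAt_one h1 (hE2 1 hn)

/-- The located residual split at the rung into the two isolation columns (EXACT). [folklore] -/
theorem jetSpecialRung_iff_iso : JetSpecialRung ↔
    (E 2 → ∀ n : ℕ, 1 ≤ n → SeqJSpecNonIso n) ∧ (E 2 → ∀ n : ℕ, 1 ≤ n → SeqJSpecIso n) :=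
  ⟨fun h => ⟨fun hE2 n hn => (seqJSpec_iff_iso.mp (h hE2 n hn)).1, fun hE2 n hn => (seqJSpec_iff_iso.mp (h hE2 n hn)).2⟩,
    fun h hE2 n hn => seqJSpec_iff_iso.mpr ⟨h.1 hE2 n hn, h.2 hE2 n hn⟩⟩

/-- The located residual split at the rung into the four LEAVES (CURVE-REGULAR, CURVE-SINGULAR, TANGLE, ISO) — EXACT.
[folklore] -/
theorem jetSpecialRung_iff_leaves : JetSpecialRung ↔
    (E 2 → ∀ n : ℕ, 1 ≤ n → SeqJSpecCurveReg n) ∧ (E 2 → ∀ n : ℕ, 1 ≤ n → SeqJSpecCurveSing n) ∧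
      (E 2 → ∀ n : ℕ, 1 ≤ n → SeqJSpecTangle n) ∧ (E 2 → ∀ n : ℕ, 1 ≤ n → SeqJSpecIso n) := by
  constructor
  · intro h
    refine ⟨fun hE2 n hn => ?_, fun hE2 n hn => ?_, fun hE2 n hn => ?_,
      fun hE2 n hn => (seqJSpec_iff_iso.mp (h hE2 n hn)).2⟩
    · exact (seqJSpecCurve_iff_reg.mp (seqJSpecNonIso_iff.mp (seqJSpec_iff_iso.mp (h hE2 n hn)).1).1).1
    · exact (seqJSpecCurve_iff_reg.mp (seqJSpecNonIso_iff.mp (seqJSpec_iff_iso.mp (h hE2 n hn)).1).1).2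
    · exact (seqJSpecNonIso_iff.mp (seqJSpec_iff_iso.mp (h hE2 n hn)).1).2
  · rintro ⟨hR, hS, hT, hI⟩ hE2 n hn
    exact seqJSpec_of_leaves (hR hE2 n hn) (hS hE2 n hn) (hT hE2 n hn) (hI hE2 n hn)

/-- `E 1` ⟺ the two families at every marking (EXACT, family level). [folklore] -/
theorem e_one_iff_families : E 1 ↔ (∀ n : ℕ, 1 ≤ n → SeqJGen n) ∧ (∀ n : ℕ, 1 ≤ n → SeqJSpec n) :=
  ⟨fun h => ⟨fun n hn => seqJGen_of_seqDimFour_one (h n hn), fun n hn => seqJSpec_of_seqDimFour_one (h n hn)⟩,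
    fun h n hn => seqDimFour_one_iff.mpr ⟨h.1 n hn, h.2 n hn⟩⟩

end Kernels

section Refinement

/-! ## §E  Refinement edges BY NAME: to g14 / g13 / g12 (restated rungs), to the tree's g10 asides 32106/32107, the g9
asides 31576/31577, and the tree's g11 rungs `DeltaGenericRung` / `DeltaSpecialRung` -/

/-- **EDGE to g14**: the decided half implies g14's decided half `PinchGenericRung` (restated). [folklore] -/
theorem pinchGenericRung_of_jetGenericRung (h : JetGenericRung) : PinchGenericRung :=
  fun hE2 n hn => seqPGen_of_seqJGen (h hE2 n hn)

/-- **EDGE from g14**: g14's located residual `PinchSpecialRung` (restated) implies this node's (the residual SHRINKS by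
letter). [folklore] -/
theorem jetSpecialRung_of_pinchSpecialRung (h : PinchSpecialRung) : JetSpecialRung :=
  fun hE2 n hn => seqJSpec_of_seqPSpec (h hE2 n hn)

/-- **EDGE from g14's REGULAR-CENTRE cell** at the rung (THE CELL this node cuts). [folklore] -/
theorem jetSpecCurveReg_of_pinchSpecCurveReg (h : E 2 → ∀ n : ℕ, 1 ≤ n → SeqPSpecCurveReg n) :
    E 2 → ∀ n : ℕ, 1 ≤ n → SeqJSpecCurveReg n :=
  fun hE2 n hn => seqJSpecCurveReg_of_seqPSpecCurveReg (h hE2 n hn)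

/-- **EDGE from g14's CURVE stratum** at the rung. [folklore] -/
theorem jetSpecCurve_of_pinchSpecCurve (h : E 2 → ∀ n : ℕ, 1 ≤ n → SeqPSpecCurve n) :
    E 2 → ∀ n : ℕ, 1 ≤ n → SeqJSpecCurve n :=
  fun hE2 n hn => seqJSpecCurve_of_seqPSpecCurve (h hE2 n hn)

/-- **EDGE from g11's NON-ISOLATED column** (tree) at the rung. [folklore] -/
theorem jetSpecNonIso_of_deltaSpecNonIso (h : E 2 → ∀ n : ℕ, 1 ≤ n → SeqDSpecNonIso n) :
    E 2 → ∀ n : ℕ, 1 ≤ n → SeqJSpecNonIso n :=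
  fun hE2 n hn => seqJSpecNonIso_of_seqDSpecNonIso (h hE2 n hn)

end Refinement

end Summit.ResolutionOfSingularities.ResolutionOfSingularities.Theorems.JetCut
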